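import Summits.HodgeConjecture.HodgeConjecture.Theorems.F0AlbCmS1bHodgeHolds
import Summits.HodgeConjecture.HodgeConjecture.Theorems.HLiu418E3AntiholOfHolHolds
import Summits.HodgeConjecture.HodgeConjecture.Theorems.F0AlbCmS1BettiHoldsSignedNoE1
import HarnessLib

/-!
# The parent line's folds WITHOUT E3antihol: `stub_S1b_hodge` modulo E3hol ∕ TPhol, `stub_S1_betti` (signed, NoE1) modulo E1′hol ∕ E3hol ∕ TPhol ∕ E₂hol

Cell `hodgecm-mathlib`, floor 0, programme P5 (`Cruxes/HLiu418/Lines/F0_AlbCm.lean`, stub `stub_S1b_hodge` ∕ packaged `stub_S1b_facts`), crux item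
`stmt-HodgeConjecture-24832`.  THEOREMS ONLY (no definition, no named fact, no instance, no `sorry`).

★ `F0AlbCmS1bHodgeHolds.stub_S1b_hodge_holds (hE3hol) (hE3antihol) (hTPhol)` concludes the body of the parent's `S1bHodgeShape` from the three named facts
E3hol ∕ E3antihol ∕ TPhol.  By ★ `HLiu418E3AntiholOfHolHolds.curveThetaHodgeTypeSigned_antihol_of_hol` (this seat's ROAD U: complex conjugation of the
`χ`-normalised doubled Weil representation + Kudla's uniqueness) E3antihol is a CONSEQUENCE of E3hol, so the same conclusion holds from E3hol and TPhol alone: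

* **`stub_S1b_hodge_holds_of_hol (hE3hol) (hTPhol)`** — conclusion token-identical to ★ `stub_S1b_hodge_holds`; the parent's packaged `stub_S1b_facts`
  may be re-cut to `E3hol` (declared floor-0 debt −1) and folded by this name;
* **`F0AlbCmS1BettiHoldsSignedNoE1.stub_S1_betti_holds_signed_of_hol (hE1'h) (hE3hol) (hDh) (hEh) : S1BettiShape`** — the signed `stub_S1_betti` fold of
  ★ `F0AlbCmS1BettiHoldsSignedNoE1.stub_S1_betti_holds_signed'` (F0P5-p03 (g2), p811554) with its E3antihol input discharged likewise.

HC_CM is proved only modulo the 7 printed citations (+ the declared floor-0 debt) until rung 0 closes; this file discharges none of the printed citations.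

## References
* [Liu2021] Y. Liu, Camb. J. Math. 9 (2021) = arXiv:2102.11518: Rem. D.5, Prop. D.4 (1), Lem. D.1 (2), Def. 4.12, proof of Thm. D.6 (1).
* [Rogawski1990] J. Rogawski, Ann. of Math. Stud. 123 (1990), §11.  [Kudla1994] S. Kudla, Israel J. Math. 87 (1994), §3 Thm. 3.1.
-/

set_option autoImplicit false
set_option linter.dupNamespace false

noncomputable section

namespace Summit.HodgeConjecture.HodgeConjecture.Cruxes.HLiu418.F0AlbCmS1bHodgeHolds

open scoped TensorProduct Matrix NumberField Kronecker ComplexOrder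
open NumberField NumberField.InfinitePlace IsDedekindDomain
open Summit.HodgeConjecture.CorCM.Model Summit.HodgeConjecture.CorCM.Model.HComp Summit.HodgeConjecture.CorCM.HComp
open Literature.AlgebraicGeometry.Motives (CMType AbelianVariety)
open Literature.AlgebraicGeometry.ShimuraVarieties Literature.AlgebraicGeometry.ShimuraVarieties.UnitaryCanonicalModel
open Literature.NumberTheory.Automorphic Literature.NumberTheory.Automorphic.UnitaryGroup Literature.NumberTheory.Automorphic.UnitaryCurveForms
open Literature.NumberTheory.Automorphic.IdeleClassGroup Literature.NumberTheory.Automorphic.Liu2021 Literature.NumberTheory.Automorphic.Liu2021.AppendixC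
open Literature.NumberTheory.GaloisRepresentations Literature.RepresentationTheory.Liu2021 Literature.RepresentationTheory.HarrisKudlaSweet1996
open Literature.AlgebraicGeometry.Liu2021 (IsAdmissibleElement)
open Literature.NumberTheory.Weil1964 Literature.NumberTheory.GelbartRogawski1991 Literature.NumberTheory.GelbartRogawski1991.UnitaryDualPair Literature.NumberTheory.GelbartRogawski1991.UnitaryDualPair.WeilCoinv
open Literature.NumberTheory.GelbartRogawski1991.UnitaryDualPair.LocalSplitting
open Literature.NumberTheory.Automorphic.Liu2021.Def411WeilCarriersDoubling
open Literature.NumberTheory.Automorphic.Liu2021.Def411WeilCarriers (TW JW JW_eq isSymm_TW isUnit_det_TW Rep Eps epsOf Chi rhoVAtLine)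
open Summit.HodgeConjecture.CorCM (CMField)
open Summit.HodgeConjecture.CorCM.Lines.A3Liu418

set_option maxHeartbeats 400000 in  -- as in ★ `stub_S1b_hodge_holds` (the `ω⋆_lab` term)
/-- **`stub_S1b_hodge_holds_of_hol` — the parent's `stub_S1b_hodge : S1bHodgeShape` MODULO E3hol AND TPhol ONLY** (E3antihol supplied by ★
`curveThetaHodgeTypeSigned_antihol_of_hol`).  Conclusion token-identical to ★ `stub_S1b_hodge_holds`.
[cite: Liu2021, Rem. D.5 p. 131; proof of Thm. D.6 (1) p. 140 (l. 5625–5631); Lem. D.1 (2) (l. 5231); Def. 4.12] [cite: Rogawski1990, §11] [cite: Kudla1994, §3 Thm. 3.1] -/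
theorem stub_S1b_hodge_holds_of_hol
    (hE3hol : Literature.NumberTheory.Rogawski1990.curveThetaHodgeTypeSigned_hol)
    (hTPhol : Literature.NumberTheory.Automorphic.UnitaryCurveForms.holCotFormSpectralProjection₂) :
    ∀ (F : CMField) [IsGalois ℚ F] (ι₁ : F →+* ℂ)
      (μ : Literature.NumberTheory.Automorphic.IdeleClassGroup (F : Type) →ₜ* Circle)
      (hμ : IdeleClassGroup.IsConjugateSymplectic (F : Type) μ)
      (_hw : IdeleClassGroup.HasWeight (F : Type) μ 1)
      (Jstar : Matrix (Fin 2) (Fin 2) (F : Type)) (t : (F : Type)) (ht : t ≠ 0) (_hτt : 0 < (ι₁ t).re) (_hτt' : (ι₁ t).im = 0)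
      (gstar : GL (Fin 2) (F : Type))
      (dJ : Fin 2 → (F : Type)) (hdJ : ∀ i, IsCMField.complexConj (F : Type) (dJ i) = dJ i) (hdJ0 : ∀ i, dJ i ≠ 0)
      (hg : formCongr ((IsCMField.complexConj (F : Type) : (F : Type) ≃ₐ[↥(maximalRealSubfield (F : Type))] (F : Type)) :
          (F : Type) →+* (F : Type)) gstar (t • Jstar) = Matrix.diagonal dJ)
      (_hsig : (∃ Tstar : GL (Fin 2) ℂ,
          formCongr (starRingEnd ℂ) Tstar ((Matrix.diagonal dJ).map ι₁) = Matrix.diagonal ![(1 : ℂ), -1]) ∧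
        ∀ τ' : (F : Type) →+* ℂ, InfinitePlace.mk τ' ≠ InfinitePlace.mk ι₁ → ((Matrix.diagonal dJ).map τ').PosDef)
      (K₀ : C5.OpenCompactSubgroup ↥(finAdelic ↥(maximalRealSubfield (F : Type)) (F : Type) (IsCMField.complexConj (F : Type)) 2 Jstar))
      (S : RecordSystemGS (F : Type) Jstar ι₁ K₀) (hU7ₛ : S.HeckeTranslateDefinedOver)
      (h4 : 4 ≤ Module.finrank ℚ (F : Type)) (isoₛ : ℕ → Prop)
      (r : Rep ↥(maximalRealSubfield (F : Type)) (imagUnitSq F))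
      (ε : Eps ↥(maximalRealSubfield (F : Type)) (imagUnitSq F))
      (_hadm : ∃ e : (F : Type), IsAdmissibleElement (F : Type) hμ.cmType.1 e ∧
        epsOf ↥(maximalRealSubfield (F : Type)) (imagUnitSq F) (F : Type) (2 * imagUnit (F : Type))⁻¹ (-e) = ε)
      (χ : Chi ↥(maximalRealSubfield (F : Type)) (F : Type) (IsCMField.complexConj (F : Type)))
      (H : Type) [AddCommGroup H] [Module ℂ H] (rhoB : Representation ℂ (sec42DataGS S h4 isoₛ).G H)
      (B : (sec42DataGS S h4 isoₛ).BettiPinning (sec42HeckeTranslatesGS S hU7ₛ h4 isoₛ) ι₁ H rhoB)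
      (K : C5.SmallLevel K₀) (y : (sec42DataGS S h4 isoₛ).bettiH1 ι₁ K),
      B.b K y ∈ ⨆ ψ : Representation.IntertwiningMap (G := (sec42DataGS S h4 isoₛ).G)
          ((rhoVAtLine ↥(maximalRealSubfield (F : Type)) (F : Type) (IsCMField.complexConj (F : Type)) 2
            (finProdFinEquiv : Fin 2 × Fin 1 ≃ Fin (2 * 1)) (Matrix.diagonal dJ)
            (complexConj_imagUnit F) (imagUnit_ne_zero F) (imagUnit_mul_self F) (realDiagonal_isSymm F dJ hdJ)
            (isUnit_det_realDiagonal F dJ hdJ hdJ0) (realDiagonal_map F dJ hdJ).symm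
            (hsChiGS F finProdFinEquiv dJ hdJ hdJ0
              (toHeckeCharacter (F : Type) (galConj (IsCMField.complexConj (F : Type)) μ))
              (isUnitary_toHeckeCharacter (F : Type) (galConj (IsCMField.complexConj (F : Type)) μ))
              ((isOscillatorChar_toHeckeCharacter_iff (galConj (IsCMField.complexConj (F : Type)) μ)).mpr hμ.galConj))
            (r.toFun ε) χ).comp
            (finAdelicCongr ↥(maximalRealSubfield (F : Type)) (F : Type) (IsCMField.complexConj (F : Type)) gstar ht hg).symm.toMonoidHom)
          rhoB, LinearMap.range ψ.toLinearMap →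
      letI : Algebra (F : Type) ℂ := algebraAlong (F : Type) ι₁
      (ι₁ ∈ hμ.cmType.1 →
        Literature.AlgebraicGeometry.HodgeTheory.IsOfHodgeType ((sec42DataGS S h4 isoₛ).A K).dim
          (((sec42DataGS S h4 isoₛ).A K).baseChange ℂ).X 1 1 0 y) ∧
      (ι₁ ∉ hμ.cmType.1 →
        Literature.AlgebraicGeometry.HodgeTheory.IsOfHodgeType ((sec42DataGS S h4 isoₛ).A K).dim
          (((sec42DataGS S h4 isoₛ).A K).baseChange ℂ).X 1 0 1 y) :=
  stub_S1b_hodge_holds hE3hol (E3AntiholOfHol.curveThetaHodgeTypeSigned_antihol_of_hol hE3hol) hTPhol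

end Summit.HodgeConjecture.HodgeConjecture.Cruxes.HLiu418.F0AlbCmS1bHodgeHolds

namespace Summit.HodgeConjecture.HodgeConjecture.Cruxes.HLiu418.F0AlbCmS1BettiHoldsSignedNoE1

/-- **`stub_S1_betti_holds_signed_of_hol` — the parent's `stub_S1_betti : S1BettiShape` from E1′hol₂, E3hol, TPhol, E₂hol ONLY** (E3antihol supplied by
★ `curveThetaHodgeTypeSigned_antihol_of_hol`; ★ `stub_S1_betti_holds_signed'` otherwise verbatim).
[cite: Liu2021, Prop. D.4 (1) p. 130–131; Rem. D.5 p. 131; Lem. D.1 (2) (l. 5231); Def. 4.12] [cite: Rogawski1990, §11] [cite: Kudla1994, §3 Thm. 3.1] -/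
theorem stub_S1_betti_holds_signed_of_hol (hE1'h : Literature.NumberTheory.Rogawski1990.curveCohFinComponentUnique_hol)
    (hE3hol : Literature.NumberTheory.Rogawski1990.curveThetaHodgeTypeSigned_hol)
    (hDh : Literature.NumberTheory.Automorphic.UnitaryCurveForms.holCotFormSpectralProjection₂)
    (hEh : Literature.NumberTheory.Automorphic.UnitaryCurveForms.cohIsotypicLine₂_hol) : F0AlbCmS1BettiHolds.S1BettiShape :=
  stub_S1_betti_holds_signed' hE1'h hE3hol (E3AntiholOfHol.curveThetaHodgeTypeSigned_antihol_of_hol hE3hol) hDh hEh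

end Summit.HodgeConjecture.HodgeConjecture.Cruxes.HLiu418.F0AlbCmS1BettiHoldsSignedNoE1

end
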